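import Summits.Ventures.PercRepro.RankLevelSetRuleQCellFiveSliceThreeSums

/-!
# PercRepro — THE SLICE STEP OF (R̂): `L(q, k, m) − L(q, k, m+1) = S₁ − C(u+k, k−1)·S_k`, UNIFORM IN `k`
(night-1, gen 18; dossier §29)

Written with the slice sums `S_j(q, m) = Σ_{a ≤ m} C(m, a) / C(q + j + a, a + j)` spelled out (no new definition): for
the untruncated lower bound `L(q, k, m) = Σ_{0<j<k} C(q + k − m, j) · S_j(q, m)` of `R̂(q, k, m)` (every
`m̂ ≤ C(q+j+a, a+j)`, `mhat_le_choose`):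
* `rhatSliceSum_succ` — **Pascal in the slice sums**: `S_j(q, m+1) = S_j(q, m) + S_{j+1}(q, m)`;
* `rhatSliceL_le_rhat` — `L(q, k, m) ≤ R̂(q, k, m)` for every `q, k, m` (the truncated top terms only help);
* **`rhatSliceL_step`** — at `q = m + 1 + u` (so `u = q − m − 1`):
  `L(q, k, m) − L(q, k, m+1) = S₁(q, m) − C(u + k, k − 1) · S_k(q, m)`
  (the Pascal steps telescoped against `C(u+k+1, j) = C(u+k, j) + C(u+k, j−1)`);
* **`phiK_le_rhat_of_sliceStep`** — hence `Φ(q+k, q) ≤ L(q, k, m+1)` and the MONOTONE STEP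
  `C(u+k, k−1)·S_k(q, m) ≤ S₁(q, m)` give `Φ(q+k, q) ≤ L(q, k, m) ≤ R̂(q, k, m)`: (R̂) climbs from the slice
  `q − #P = u` to the slice `u + 1` whenever the `k`-th slice sum is small against the first — the mechanism of the
  band above the borderline slice.
Axioms: standard.
-/

namespace PercRepro

open Finset

/-- **Pascal in the slice sums**: `S_j(q, m+1) = S_j(q, m) + S_{j+1}(q, m)`. -/
lemma rhatSliceSum_succ (q m j : ℕ) :
    ∑ a ∈ range (m + 1 + 1), ((m + 1).choose a : ℚ) / ((q + j + a).choose (a + j) : ℚ)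
      = ∑ a ∈ range (m + 1), (m.choose a : ℚ) / ((q + j + a).choose (a + j) : ℚ)
        + ∑ a ∈ range (m + 1), (m.choose a : ℚ) / ((q + (j + 1) + a).choose (a + (j + 1)) : ℚ) := by
  rw [Finset.sum_range_succ' (fun a => ((m + 1).choose a : ℚ) / ((q + j + a).choose (a + j) : ℚ)) (m + 1)]
  have hsplit : ∀ a ∈ range (m + 1),
      ((m + 1).choose (a + 1) : ℚ) / ((q + j + (a + 1)).choose (a + 1 + j) : ℚ)
        = (m.choose (a + 1) : ℚ) / ((q + j + (a + 1)).choose (a + 1 + j) : ℚ)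
          + (m.choose a : ℚ) / ((q + (j + 1) + a).choose (a + (j + 1)) : ℚ) := by
    intro a _
    rw [Nat.choose_succ_succ, show q + (j + 1) + a = q + j + (a + 1) by ring,
      show a + (j + 1) = a + 1 + j by ring]
    push_cast
    rw [add_div, Nat.succ_eq_add_one, add_comm]
  rw [Finset.sum_congr rfl hsplit, Finset.sum_add_distrib]
  have htop : ∑ a ∈ range (m + 1), (m.choose (a + 1) : ℚ) / ((q + j + (a + 1)).choose (a + 1 + j) : ℚ)
      + ((m + 1).choose 0 : ℚ) / ((q + j + 0).choose (0 + j) : ℚ)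
      = ∑ a ∈ range (m + 1), (m.choose a : ℚ) / ((q + j + a).choose (a + j) : ℚ) := by
    rw [Finset.sum_range_succ' (fun a => (m.choose a : ℚ) / ((q + j + a).choose (a + j) : ℚ)) m,
      Finset.sum_range_succ (fun a => (m.choose (a + 1) : ℚ) / ((q + j + (a + 1)).choose (a + 1 + j) : ℚ)) m,
      Nat.choose_succ_self, Nat.choose_zero_right, Nat.choose_zero_right]
    push_cast
    ring
  linarith [htop]

/-- `L(q, k, m) ≤ R̂(q, k, m)`: every swap count `m̂(q, m; a, j) ≤ C(q + j + a, a + j)` (`mhat_le_choose`). -/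
lemma rhatSliceL_le_rhat (q k m : ℕ) :
    ∑ j ∈ Finset.Ioo 0 k, ((q + k - m).choose j : ℚ)
        * ∑ a ∈ range (m + 1), (m.choose a : ℚ) / ((q + j + a).choose (a + j) : ℚ)
      ≤ rhat q k m := by
  unfold rhat
  refine Finset.sum_le_sum (fun j _ => ?_)
  rw [Finset.mul_sum]
  refine Finset.sum_le_sum (fun a _ => ?_)
  rw [show ((q + k - m).choose j : ℚ) * ((m.choose a : ℚ) / ((q + j + a).choose (a + j) : ℚ))
      = ((m.choose a * (q + k - m).choose j : ℕ) : ℚ) / ((q + j + a).choose (a + j) : ℚ) by push_cast; ring]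
  apply div_le_div_of_nonneg_left (by positivity) (by exact_mod_cast mhat_pos q m a j)
  exact_mod_cast mhat_le_choose q m a j

/-- **The slice step**, at `q = m + 1 + u`: `L(q, k, m) − L(q, k, m+1) = S₁(q, m) − C(u + k, k − 1) · S_k(q, m)`. -/
theorem rhatSliceL_step (u k m : ℕ) (hk : 1 ≤ k) :
    ∑ j ∈ Finset.Ioo 0 k, ((m + 1 + u + k - m).choose j : ℚ)
        * ∑ a ∈ range (m + 1), (m.choose a : ℚ) / ((m + 1 + u + j + a).choose (a + j) : ℚ)
      - ∑ j ∈ Finset.Ioo 0 k, ((m + 1 + u + k - (m + 1)).choose j : ℚ)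
        * ∑ a ∈ range (m + 1 + 1), ((m + 1).choose a : ℚ) / ((m + 1 + u + j + a).choose (a + j) : ℚ)
      = ∑ a ∈ range (m + 1), (m.choose a : ℚ) / ((m + 1 + u + 1 + a).choose (a + 1) : ℚ)
        - ((u + k).choose (k - 1) : ℚ)
          * ∑ a ∈ range (m + 1), (m.choose a : ℚ) / ((m + 1 + u + k + a).choose (a + k) : ℚ) := by
  rw [show m + 1 + u + k - m = u + k + 1 by omega, show m + 1 + u + k - (m + 1) = u + k by omega,
    sum_Ioo_nat, sum_Ioo_nat, show k - (0 + 1) = k - 1 by omega, ← Finset.sum_sub_distrib]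
  have hterm : ∀ i ∈ range (k - 1),
      ((u + k + 1).choose (0 + 1 + i) : ℚ)
          * ∑ a ∈ range (m + 1), (m.choose a : ℚ) / ((m + 1 + u + (0 + 1 + i) + a).choose (a + (0 + 1 + i)) : ℚ)
        - ((u + k).choose (0 + 1 + i) : ℚ)
          * ∑ a ∈ range (m + 1 + 1), ((m + 1).choose a : ℚ) / ((m + 1 + u + (0 + 1 + i) + a).choose (a + (0 + 1 + i)) : ℚ)
      = ((u + k).choose i : ℚ)
          * ∑ a ∈ range (m + 1), (m.choose a : ℚ) / ((m + 1 + u + (i + 1) + a).choose (a + (i + 1)) : ℚ)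
        - ((u + k).choose (i + 1) : ℚ)
          * ∑ a ∈ range (m + 1), (m.choose a : ℚ) / ((m + 1 + u + (i + 1 + 1) + a).choose (a + (i + 1 + 1)) : ℚ) := by
    intro i _
    rw [show 0 + 1 + i = i + 1 by ring, rhatSliceSum_succ, Nat.choose_succ_succ]
    push_cast
    ring
  rw [Finset.sum_congr rfl hterm, Finset.sum_range_sub' (fun i => ((u + k).choose i : ℚ)
    * ∑ a ∈ range (m + 1), (m.choose a : ℚ) / ((m + 1 + u + (i + 1) + a).choose (a + (i + 1)) : ℚ))]
  simp only [Nat.choose_zero_right, Nat.cast_one, one_mul, zero_add]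
  rw [show k - 1 + 1 = k by omega]

/-- **The monotone step of (R̂)**: `Φ ≤ L(q, k, m+1)` and `C(u+k, k−1)·S_k(q, m) ≤ S₁(q, m)` give `Φ ≤ L(q, k, m)`
(`q = m + 1 + u`). -/
theorem phiK_le_rhatSliceL_of_step (u k m : ℕ) (hk : 1 ≤ k)
    (h1 : phiK (m + 1 + u + k) (m + 1 + u)
      ≤ ∑ j ∈ Finset.Ioo 0 k, ((m + 1 + u + k - (m + 1)).choose j : ℚ)
          * ∑ a ∈ range (m + 1 + 1), ((m + 1).choose a : ℚ) / ((m + 1 + u + j + a).choose (a + j) : ℚ))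
    (h2 : ((u + k).choose (k - 1) : ℚ)
        * ∑ a ∈ range (m + 1), (m.choose a : ℚ) / ((m + 1 + u + k + a).choose (a + k) : ℚ)
      ≤ ∑ a ∈ range (m + 1), (m.choose a : ℚ) / ((m + 1 + u + 1 + a).choose (a + 1) : ℚ)) :
    phiK (m + 1 + u + k) (m + 1 + u)
      ≤ ∑ j ∈ Finset.Ioo 0 k, ((m + 1 + u + k - m).choose j : ℚ)
          * ∑ a ∈ range (m + 1), (m.choose a : ℚ) / ((m + 1 + u + j + a).choose (a + j) : ℚ) := by
  have h := rhatSliceL_step u k m hk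
  linarith

/-- **(R̂) climbs one slice**: `Φ ≤ L(q, k, m+1)` and the monotone step give `Φ(q+k, q) ≤ R̂(q, k, m)` (`q = m + 1 + u`). -/
theorem phiK_le_rhat_of_sliceStep (u k m : ℕ) (hk : 1 ≤ k)
    (h1 : phiK (m + 1 + u + k) (m + 1 + u)
      ≤ ∑ j ∈ Finset.Ioo 0 k, ((m + 1 + u + k - (m + 1)).choose j : ℚ)
          * ∑ a ∈ range (m + 1 + 1), ((m + 1).choose a : ℚ) / ((m + 1 + u + j + a).choose (a + j) : ℚ))
    (h2 : ((u + k).choose (k - 1) : ℚ)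
        * ∑ a ∈ range (m + 1), (m.choose a : ℚ) / ((m + 1 + u + k + a).choose (a + k) : ℚ)
      ≤ ∑ a ∈ range (m + 1), (m.choose a : ℚ) / ((m + 1 + u + 1 + a).choose (a + 1) : ℚ)) :
    phiK (m + 1 + u + k) (m + 1 + u) ≤ rhat (m + 1 + u) k m :=
  (phiK_le_rhatSliceL_of_step u k m hk h1 h2).trans (rhatSliceL_le_rhat _ _ _)

end PercRepro
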